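import Literature.NumberTheory.Sieve.IntervalResidueClassSieve
import HarnessLib

/-!
# The signed interval residue-class sieve

Topic `Literature/NumberTheory/Sieve`.  Fully proved, no definition and no new fact: the SIGNED twin
of the counting fundamental lemma `IntervalClassSieve.abs_card_sub_le`
(`IntervalResidueClassSieve.lean`).  For every `D : ℕ` there is `C = C(D) > 0` such that for every
length `X : ℕ`, every choice of residue classes `Ω p ⊆ {0, …, p − 1}` with `#Ω p ≤ D` and `#Ω p < p`
at every prime `p`, all `2 ≤ z ≤ L` and EVERY weight `σ : ℕ → ℝ` with `|σ| ≤ 1`,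

  `|∑_{1 ≤ n ≤ X, n mod p ∉ Ω p ∀ p < z} σ(n)| ≤ C·X·V(z)·e^{−log L/log z} + L²`
  `    + ∑_{d ∣ P(z), d ≤ L} ∑_{c mod d admissible} |∑_{1 ≤ n ≤ X, n ≡ c (d)} σ(n)|`,
  `V(z) = ∏_{p < z} (1 − #Ω p/p)`,

where `c mod d` is admissible iff `c mod q ∈ Ω q` for every prime `q ∣ d`
(`IntervalClassSieve.abs_signedSum_le`).  This is the classical device of sifting the two
NON-NEGATIVE sequences `(1 ± σ(n))/2` (Halberstam–Richert, *Sieve Methods*, Thm 2.5 applied to the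
sequence of their Example 1 with weights; Friedlander–Iwaniec, *Opera de Cribro*, Cor. 6.10) and
subtracting: the main terms `(X/2)·V(z)` cancel, the sifted sums subtract to `∑_sifted σ`, and each
remainder `R_d^±` splits into the counting remainder (`≤ d`, periodicity and the Chinese remainder
count, exactly `IntervalClassSieve.abs_remainder_le`) and `± ½ ∑_{d ∣ N(n)} σ(n)`, the latter being
the sum of `σ` over the admissible residue classes modulo `d`.

## Contents (sub-namespace `IntervalClassSieve`)

* weighted dictionary for the encoding `N(n) = ∏_{p < z, n mod p ∈ Ω p} p` of
  `IntervalResidueClassSieve.lean` with weights `a_m = ∑_{n ≤ X, N(n) = m} w(n)`: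
  `sum_a_filter_eq_sum`, `congrSum_eq_sum`, `sifted_eq_sum`;
* `abs_card_filter_sub_le`: `|#{n ≤ X : n mod q ∈ Ω q ∀ q ∣ d} − g(d) X| ≤ d` for squarefree `d`;
* `sum_filter_eq_sum_classes`:
  `∑_{n ≤ X, n mod q ∈ Ω q ∀ q ∣ d} σ(n) = ∑_{c adm} ∑_{n ≡ c (d)} σ(n)`;
* `abs_weightedSum_sub_le`: the uniform Fundamental Lemma for the interval with an arbitrary
  non-negative weight `w` and size parameter `S ≥ 0` (remainders left explicit);
* `abs_signedSum_le`: the signed bound displayed above.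

First client: the signed sieve-out along a Bateman–Horn system (`Summits/Parity/BatemanHorn`,
crux `RoughParityBalance`), where `σ` is the Liouville function along a member of the system.

## References

* H. Halberstam, H.-E. Richert, *Sieve Methods* (1974), Ch. 1 (Example 1), Thm 2.5.
  [HalberstamRichert1974]
* J. Friedlander, H. Iwaniec, *Opera de Cribro* (2010), Cor. 6.10.  [FriedlanderIwaniecOpera2010]
-/

noncomputable section

open Finset

namespace Literature.NumberTheory.Sieve

namespace IntervalClassSieve

open Lichtman2020 (card_filter_range_prod_eq_prod_card)
open BoundedClassDensity (isMultiplicative_of_apply_eq_prod hasSieveDimension_of_card_le)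

/-! ### Weighted dictionary for the sequence `a_m = ∑_{n ≤ X, N(n) = m} w(n)` -/

/-- Weighted fibre sum: if `a_m = ∑_{n ≤ X, N(n) = m} w(n)` and `0 < N ≤ B`, then summing the
weights over the `m ≤ B` with `C m` gives `∑_{n ≤ X, C (N n)} w(n)`. [folklore] -/
theorem sum_a_filter_eq_sum {A : SieveSequence} {X B : ℕ} {N : ℕ → ℕ} {w : ℕ → ℝ}
    (ha : ∀ m, A.a m = ∑ n ∈ {n ∈ Icc 1 X | N n = m}, w n) (hN0 : ∀ n, 0 < N n)
    (hNB : ∀ n, N n ≤ B) (C : ℕ → Prop) [DecidablePred C] :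
    ∑ m ∈ (Ioc 0 B).filter C, A.a m = ∑ n ∈ {n ∈ Icc 1 X | C (N n)}, w n := by
  rw [← Finset.sum_fiberwise_of_maps_to (s := {n ∈ Icc 1 X | C (N n)}) (t := (Ioc 0 B).filter C)
    (g := N) ?_ w]
  · refine Finset.sum_congr rfl fun m hm => ?_
    rw [ha m]
    refine Finset.sum_congr ?_ fun _ _ => rfl
    have hCm : C m := (Finset.mem_filter.mp hm).2
    ext n
    simp only [Finset.mem_filter]
    constructor
    · rintro ⟨h1, h3⟩
      exact ⟨⟨h1, by rw [h3]; exact hCm⟩, h3⟩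
    · rintro ⟨⟨h1, _⟩, h3⟩
      exact ⟨h1, h3⟩
  · intro n hn
    rw [Finset.mem_filter] at hn
    rw [Finset.mem_filter, Finset.mem_Ioc]
    exact ⟨⟨hN0 n, hNB n⟩, hn.2⟩

/-- The congruence sums of the weighted sequence: `A_d = ∑_{n ≤ X, d ∣ N(n)} w(n)`. [folklore] -/
theorem congrSum_eq_sum {A : SieveSequence} {X B : ℕ} {N : ℕ → ℕ} {w : ℕ → ℝ}
    (ha : ∀ m, A.a m = ∑ n ∈ {n ∈ Icc 1 X | N n = m}, w n) (hN0 : ∀ n, 0 < N n)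
    (hNB : ∀ n, N n ≤ B) (d : ℕ) : A.congrSum d B = ∑ n ∈ {n ∈ Icc 1 X | d ∣ N n}, w n := by
  rw [SieveSequence.congrSum, Nat.floor_natCast]
  exact sum_a_filter_eq_sum ha hN0 hNB (d ∣ ·)

/-- The sifting function of the weighted sequence: `S(𝒜, P) = ∑_{n ≤ X, (N(n), P) = 1} w(n)`.
[folklore] -/
theorem sifted_eq_sum {A : SieveSequence} {X B : ℕ} {N : ℕ → ℕ} {w : ℕ → ℝ}
    (ha : ∀ m, A.a m = ∑ n ∈ {n ∈ Icc 1 X | N n = m}, w n) (hN0 : ∀ n, 0 < N n)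
    (hNB : ∀ n, N n ≤ B) (P : ℕ) :
    A.sifted B P = ∑ n ∈ {n ∈ Icc 1 X | (N n).Coprime P}, w n := by
  rw [SieveSequence.sifted, Nat.floor_natCast]
  exact sum_a_filter_eq_sum ha hN0 hNB (fun m => m.Coprime P)

/-! ### The counting remainder and the class decomposition modulo `d` -/

/-- **Counting remainder**: for squarefree `d` and classes `Ω q ⊆ {0, …, q − 1}`,
`|#{1 ≤ n ≤ X : n mod q ∈ Ω q ∀ q ∣ d} − (∏_{q ∣ d} #Ω q/q)·X| ≤ ∏_{q ∣ d} #Ω q ≤ d`, by periodicity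
modulo `d` and the Chinese remainder count (Halberstam–Richert Ch. 1, Example 1 / condition (R)).
[folklore] -/
theorem abs_card_filter_sub_le {Ω : ℕ → Finset ℕ} (hΩ : ∀ p : ℕ, p.Prime → ∀ r ∈ Ω p, r < p)
    {d : ℕ} (hd : Squarefree d) (X : ℕ) :
    |(#{n ∈ Icc 1 X | ∀ q ∈ d.primeFactors, n % q ∈ Ω q} : ℝ) -
        (∏ p ∈ d.primeFactors, (#(Ω p) : ℝ) / p) * X| ≤ d := by
  have hd0 : 0 < d := Nat.pos_of_ne_zero hd.ne_zero
  set cond : ℕ → Prop := fun n => ∀ q ∈ d.primeFactors, n % q ∈ Ω q with hcond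
  have hper : Function.Periodic cond d := by
    intro n
    simp only [hcond, eq_iff_iff]
    refine forall₂_congr fun q hq => ?_
    obtain ⟨k, hk⟩ := Nat.dvd_of_mem_primeFactors hq
    rw [show (n + d) % q = n % q by rw [hk, Nat.add_mul_mod_self_left]]
  have hcount : Nat.count cond d = ∏ q ∈ d.primeFactors, #(Ω q) := by
    rw [Nat.count_eq_card_filter_range]
    have := card_filter_range_prod_eq_prod_card d.primeFactors
      (fun q hq => Nat.prime_of_mem_primeFactors hq) Ω
      (fun q hq => hΩ q (Nat.prime_of_mem_primeFactors hq))
    rw [Nat.prod_primeFactors_of_squarefree hd] at this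
    exact this
  have hcle : Nat.count cond d ≤ d := Nat.count_le _
  have hmain := BrunTwinPrimes.abs_card_filter_Icc_sub_le hd0 cond hper X
  have hdcast : (d : ℝ) = ∏ q ∈ d.primeFactors, (q : ℝ) := by
    rw [← Nat.cast_prod, Nat.prod_primeFactors_of_squarefree hd]
  have hdens' : (∏ p ∈ d.primeFactors, (#(Ω p) : ℝ) / p) * X =
      (X : ℝ) * (Nat.count cond d : ℝ) / d := by
    rw [Finset.prod_div_distrib, ← hdcast, hcount]
    push_cast
    ring
  rw [hdens']
  have hcle' : (Nat.count cond d : ℝ) ≤ d := by exact_mod_cast hcle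
  exact hmain.trans hcle'

/-- **Class decomposition**: for `0 < d`, the `n ≤ X` with `n mod q ∈ Ω q` for every prime `q ∣ d`
are the disjoint union, over the admissible residues `c mod d` (`c mod q ∈ Ω q` for every prime
`q ∣ d`), of the `n ≤ X` with `n ≡ c (mod d)`; hence the sum of any `σ` splits accordingly.
[folklore] -/
theorem sum_filter_eq_sum_classes (Ω : ℕ → Finset ℕ) {d : ℕ} (hd : 0 < d) (X : ℕ) (σ : ℕ → ℝ) :
    ∑ n ∈ {n ∈ Icc 1 X | ∀ q ∈ d.primeFactors, n % q ∈ Ω q}, σ n =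
      ∑ c ∈ {c ∈ range d | ∀ q ∈ d.primeFactors, c % q ∈ Ω q},
        ∑ n ∈ {n ∈ Icc 1 X | n % d = c}, σ n := by
  have hmod : ∀ n, ∀ q ∈ d.primeFactors, n % d % q = n % q := fun n q hq =>
    Nat.mod_mod_of_dvd n (Nat.dvd_of_mem_primeFactors hq)
  rw [← Finset.sum_fiberwise_of_maps_to (s := {n ∈ Icc 1 X | ∀ q ∈ d.primeFactors, n % q ∈ Ω q})
    (t := {c ∈ range d | ∀ q ∈ d.primeFactors, c % q ∈ Ω q}) (g := fun n => n % d) ?_ σ]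
  · refine Finset.sum_congr rfl fun c hc => Finset.sum_congr ?_ fun _ _ => rfl
    rw [Finset.mem_filter] at hc
    ext n
    simp only [Finset.mem_filter]
    constructor
    · rintro ⟨⟨h1, _⟩, h3⟩
      exact ⟨h1, h3⟩
    · rintro ⟨h1, h3⟩
      refine ⟨⟨h1, fun q hq => ?_⟩, h3⟩
      rw [← hmod n q hq, h3]
      exact hc.2 q hq
  · intro n hn
    rw [Finset.mem_filter] at hn
    rw [Finset.mem_filter, Finset.mem_range]
    exact ⟨Nat.mod_lt n hd, fun q hq => by rw [hmod n q hq]; exact hn.2 q hq⟩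

/-! ### The fundamental lemma for the interval with a non-negative weight -/

/-- **The weighted fundamental lemma for an interval sifted by prescribed residue classes.**  For
every `D` there is `C = C(D) > 0` such that for every `X : ℕ`, all classes `Ω p` with `#Ω p ≤ D` and
`#Ω p < p` at every prime `p`, all `2 ≤ z ≤ L`, every weight `w ≥ 0` and every `S ≥ 0`:
`|∑_{n ≤ X, n mod p ∉ Ω p ∀ p < z} w(n) − S V(z)| ≤ C S V(z) e^{−log L/log z}`
`  + ∑_{d ∣ P(z), d ≤ L} |∑_{n ≤ X, n mod q ∈ Ω q ∀ q ∣ d} w(n) − g(d) S|`,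
`V(z) = ∏_{p<z} (1 − #Ω p/p)`, `g(d) = ∏_{q ∣ d} #Ω q/q`: the tree's PROVED uniform Fundamental
Lemma `SieveSequence.fundamental_lemma_uniform_holds` for the sequence
`a_m = ∑_{n ≤ X, N(n) = m} w(n)` of the values `N(n) = ∏_{p<z, n mod p ∈ Ω p} p` (dimension `2D`),
with the dictionary of this file (Halberstam–Richert Thm 2.5; Friedlander–Iwaniec Cor. 6.10).
[folklore] -/
theorem abs_weightedSum_sub_le (D : ℕ) :
    ∃ C : ℝ, 0 < C ∧ ∀ (X : ℕ) (Ω : ℕ → Finset ℕ),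
      (∀ p : ℕ, p.Prime → #(Ω p) ≤ D) → (∀ p : ℕ, p.Prime → #(Ω p) < p) →
      ∀ z L : ℝ, 2 ≤ z → z ≤ L → ∀ w : ℕ → ℝ, (∀ n, 0 ≤ w n) → ∀ S : ℝ, 0 ≤ S →
        |∑ n ∈ {n ∈ Icc 1 X | ∀ p ∈ Nat.primesBelow ⌈z⌉₊, n % p ∉ Ω p}, w n -
            S * ∏ p ∈ Nat.primesBelow ⌈z⌉₊, (1 - (#(Ω p) : ℝ) / p)| ≤
          C * S * (∏ p ∈ Nat.primesBelow ⌈z⌉₊, (1 - (#(Ω p) : ℝ) / p)) *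
              Real.exp (-(Real.log L / Real.log z)) +
            ∑ d ∈ (primesProdBelow z).divisors.filter (fun d : ℕ => (d : ℝ) ≤ L),
              |∑ n ∈ {n ∈ Icc 1 X | ∀ q ∈ d.primeFactors, n % q ∈ Ω q}, w n -
                (∏ p ∈ d.primeFactors, (#(Ω p) : ℝ) / p) * S| := by
  obtain ⟨C, hC, hFL⟩ := SieveSequence.fundamental_lemma_uniform_holds (2 * D)
    (((2 * D + 1 : ℕ) : ℝ) ^ (2 * D + 1) * Real.exp (2 * D * (9 / 2 + 6 / Real.log 2)))
  refine ⟨C, hC, fun X Ω hle hlt z L hz hzL w hw S hS => ?_⟩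
  -- the encoding, the density and the weighted sequence
  obtain ⟨M, hM⟩ : ∃ M : ℕ, M = ⌈z⌉₊ := ⟨_, rfl⟩
  obtain ⟨N, hN, hN0, hNB⟩ : ∃ N : ℕ → ℕ, (∀ n q : ℕ, q.Prime → (q ∣ N n ↔ q < M ∧ n % q ∈ Ω q)) ∧
      (∀ n, 0 < N n) ∧ ∀ n, N n ≤ ∏ p ∈ Nat.primesBelow M, p :=
    ⟨fun n => ∏ p ∈ (Nat.primesBelow M).filter (fun p => n % p ∈ Ω p), p,
      fun n q hq => prime_dvd_classProd_iff Ω M n hq, fun n => classProd_pos Ω M n,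
      fun n => classProd_le Ω M n⟩
  obtain ⟨g, hg⟩ : ∃ g : ArithmeticFunction ℝ,
      ∀ d : ℕ, d ≠ 0 → g d = ∏ p ∈ d.primeFactors, (#(Ω p) : ℝ) / p :=
    ⟨⟨fun d => if d = 0 then 0 else ∏ p ∈ d.primeFactors, (#(Ω p) : ℝ) / p, if_pos rfl⟩,
      fun d hd => if_neg hd⟩
  have hgp : ∀ p : ℕ, p.Prime → g p = ((#(Ω p) : ℕ) : ℝ) / p := fun p hp => by
    rw [hg p hp.ne_zero, hp.primeFactors, Finset.prod_singleton]
  have hdim := hasSieveDimension_of_card_le hgp hle hlt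
  obtain ⟨A, ha, hsize, hdens⟩ : ∃ A : SieveSequence,
      (∀ m, A.a m = ∑ n ∈ {n ∈ Icc 1 X | N n = m}, w n) ∧ (∀ t, A.size t = S) ∧
      ∀ d : ℕ, d ≠ 0 → A.density d = ∏ p ∈ d.primeFactors, (#(Ω p) : ℝ) / p :=
    ⟨⟨fun m => ∑ n ∈ {n ∈ Icc 1 X | N n = m}, w n, fun _ => Finset.sum_nonneg fun n _ => hw n,
      fun _ => S, g, isMultiplicative_of_apply_eq_prod hg⟩, fun _ => rfl, fun _ => rfl, hg⟩
  have hdimA : HasSieveDimension A.density (2 * D)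
      (((2 * D + 1 : ℕ) : ℝ) ^ (2 * D + 1) * Real.exp (2 * D * (9 / 2 + 6 / Real.log 2))) := by
    refine ⟨fun p hp => ?_, fun w' z' hw' hwz => ?_⟩
    · rw [hdens p hp.ne_zero, ← hg p hp.ne_zero]; exact hdim.1 p hp
    · refine le_of_eq_of_le (Finset.prod_congr rfl fun p hp => ?_) (hdim.2 w' z' hw' hwz)
      have hpp := Nat.prime_of_mem_primesBelow (Finset.mem_filter.mp hp).1
      rw [hdens p hpp.ne_zero, ← hg p hpp.ne_zero]
  set B : ℕ := ∏ p ∈ Nat.primesBelow M, p with hB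
  have h := hFL A hdimA (B : ℝ) z L hz hzL (by rw [hsize]; exact hS)
  -- identify the sifting function, the main term and the remainders
  have hSift : A.sifted B (primesProdBelow z) =
      ∑ n ∈ {n ∈ Icc 1 X | ∀ p ∈ Nat.primesBelow ⌈z⌉₊, n % p ∉ Ω p}, w n := by
    have hset : {n ∈ Icc 1 X | (N n).Coprime (primesProdBelow z)} =
        {n ∈ Icc 1 X | ∀ p ∈ Nat.primesBelow ⌈z⌉₊, n % p ∉ Ω p} := by
      refine Finset.filter_congr fun n _ => ?_
      rw [coprime_primesProdBelow_iff]
      refine forall₂_congr fun q hq => ?_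
      rw [Nat.mem_primesBelow] at hq
      rw [hN n q hq.2, hM]
      exact ⟨fun h1 h2 => h1 ⟨hq.1, h2⟩, fun h1 h2 => h1 h2.2⟩
    rw [sifted_eq_sum ha hN0 hNB, hset]
  have hV : A.densityProduct (primesProdBelow z) =
      ∏ p ∈ Nat.primesBelow ⌈z⌉₊, (1 - (#(Ω p) : ℝ) / p) := densityProduct_eq hdens z
  have hR : ∀ d ∈ (primesProdBelow z).divisors.filter (fun d : ℕ => (d : ℝ) ≤ L),
      |A.remainder d B| = |∑ n ∈ {n ∈ Icc 1 X | ∀ q ∈ d.primeFactors, n % q ∈ Ω q}, w n -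
        (∏ p ∈ d.primeFactors, (#(Ω p) : ℝ) / p) * S| := by
    intro d hd
    rw [Finset.mem_filter, Nat.mem_divisors] at hd
    have hsq : Squarefree d := (squarefree_primesProdBelow z).squarefree_of_dvd hd.1.1
    have hdM : ∀ q ∈ d.primeFactors, q < M := fun q hq => by
      rw [hM]
      exact Nat.lt_ceil.mpr ((dvd_primesProdBelow_iff (Nat.prime_of_mem_primeFactors hq) z).mp
        ((Nat.dvd_of_mem_primeFactors hq).trans hd.1.1))
    have hfilter : {n ∈ Icc 1 X | d ∣ N n} = {n ∈ Icc 1 X | ∀ q ∈ d.primeFactors, n % q ∈ Ω q} := by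
      refine Finset.filter_congr fun n _ => ?_
      rw [dvd_iff_forall_primeFactors hN hsq]
      exact forall₂_congr fun q hq => and_iff_right (hdM q hq)
    rw [SieveSequence.remainder, congrSum_eq_sum ha hN0 hNB, hfilter, hsize, hdens d hsq.ne_zero]
  rw [hSift, hsize, hV, Finset.sum_congr rfl hR] at h
  exact h

/-! ### The signed interval residue-class sieve -/

/-- `|x| + |y| ≤ |x + y| + |x − y|` for real numbers. [folklore] -/
private theorem abs_add_abs_le_abs_add_add_abs_sub (x y : ℝ) :
    |x| + |y| ≤ |x + y| + |x - y| := by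
  have h1 : |(x + y) + (x - y)| ≤ |x + y| + |x - y| := abs_add_le _ _
  have h2 : |(x + y) - (x - y)| ≤ |x + y| + |x - y| := abs_sub _ _
  rw [show (x + y) + (x - y) = 2 * x by ring, abs_mul, abs_two] at h1
  rw [show (x + y) - (x - y) = 2 * y by ring, abs_mul, abs_two] at h2
  linarith [abs_nonneg x, abs_nonneg y]

/-- Book-keeping of the subtraction of the two one-sided bounds: the common main term cancels and
the remainders are split term by term. [folklore] -/
private theorem abs_sub_le_of_two_sided {ι : Type*} {F : Finset ι} {S₁ S₂ m c b : ℝ}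
    {R₁ R₂ r e : ι → ℝ} (h₁ : |S₁ - m| ≤ c + ∑ d ∈ F, |R₁ d|)
    (h₂ : |S₂ - m| ≤ c + ∑ d ∈ F, |R₂ d|) (hd : ∀ d ∈ F, |R₁ d| + |R₂ d| ≤ r d + e d)
    (hr : ∑ d ∈ F, r d ≤ b) : |S₁ - S₂| ≤ 2 * c + b + ∑ d ∈ F, e d := by
  have h3 : |S₁ - S₂| ≤ |S₁ - m| + |S₂ - m| := by
    calc |S₁ - S₂| ≤ |S₁ - m| + |m - S₂| := abs_sub_le _ _ _
      _ = |S₁ - m| + |S₂ - m| := by rw [abs_sub_comm m]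
  have h4 : ∑ d ∈ F, |R₁ d| + ∑ d ∈ F, |R₂ d| ≤ ∑ d ∈ F, r d + ∑ d ∈ F, e d := by
    rw [← Finset.sum_add_distrib, ← Finset.sum_add_distrib]
    exact Finset.sum_le_sum hd
  linarith

/-- **The signed interval residue-class sieve.**  For every `D` there is `C = C(D) > 0` such that
for every `X : ℕ`, all classes `Ω p ⊆ {0, …, p − 1}` with `#Ω p ≤ D` and `#Ω p < p` at every prime
`p`, all `2 ≤ z ≤ L` and every weight `σ : ℕ → ℝ` with `|σ| ≤ 1`:
`|∑_{1 ≤ n ≤ X, n mod p ∉ Ω p ∀ p < z} σ(n)| ≤ C X V(z) e^{−log L/log z} + L²`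
`  + ∑_{d ∣ P(z), d ≤ L} ∑_{c mod d : c mod q ∈ Ω q ∀ q ∣ d} |∑_{1 ≤ n ≤ X, n ≡ c (d)} σ(n)|`,
`V(z) = ∏_{p<z} (1 − #Ω p/p)`.  Proof: the weighted fundamental lemma `abs_weightedSum_sub_le` for
the two non-negative weights `(1 ± σ)/2` with size `X/2`; subtracting, the main terms cancel and the
sifted sums give `∑_sifted σ`; each pair of remainders is bounded by the counting remainder (`≤ d`,
`abs_card_filter_sub_le`, summing to `≤ L²`) plus `|∑_{n mod q ∈ Ω q ∀ q ∣ d} σ|`, which is split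
over the admissible classes modulo `d` (`sum_filter_eq_sum_classes`) (Halberstam–Richert Thm 2.5 for
the sequence of Example 1 with weights; Friedlander–Iwaniec Cor. 6.10). [folklore] -/
theorem abs_signedSum_le (D : ℕ) :
    ∃ C : ℝ, 0 < C ∧ ∀ (X : ℕ) (Ω : ℕ → Finset ℕ),
      (∀ p : ℕ, p.Prime → ∀ r ∈ Ω p, r < p) → (∀ p : ℕ, p.Prime → #(Ω p) ≤ D) →
      (∀ p : ℕ, p.Prime → #(Ω p) < p) →
      ∀ z L : ℝ, 2 ≤ z → z ≤ L → ∀ σ : ℕ → ℝ, (∀ n, |σ n| ≤ 1) →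
        |∑ n ∈ (Finset.Icc 1 X).filter (fun n : ℕ => ∀ p ∈ Nat.primesBelow ⌈z⌉₊, n % p ∉ Ω p),
            σ n| ≤
          C * X * (∏ p ∈ Nat.primesBelow ⌈z⌉₊, (1 - (#(Ω p) : ℝ) / p)) *
              Real.exp (-(Real.log L / Real.log z)) + L ^ 2 +
          ∑ d ∈ (primesProdBelow z).divisors.filter (fun d : ℕ => (d : ℝ) ≤ L),
            ∑ c ∈ (Finset.range d).filter (fun c : ℕ => ∀ q ∈ d.primeFactors, c % q ∈ Ω q),
              |∑ n ∈ (Finset.Icc 1 X).filter (fun n : ℕ => n % d = c), σ n| := by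
  obtain ⟨C, hC, hW⟩ := abs_weightedSum_sub_le D
  refine ⟨C, hC, fun X Ω hΩ hle hlt z L hz hzL σ hσ => ?_⟩
  have hw₁ : ∀ n, 0 ≤ (1 + σ n) / 2 := fun n => by
    have := (abs_le.mp (hσ n)).1
    linarith
  have hw₂ : ∀ n, 0 ≤ (1 - σ n) / 2 := fun n => by
    have := (abs_le.mp (hσ n)).2
    linarith
  have hX2 : (0 : ℝ) ≤ (X : ℝ) / 2 := by positivity
  have h₁ := hW X Ω hle hlt z L hz hzL (fun n => (1 + σ n) / 2) hw₁ ((X : ℝ) / 2) hX2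
  have h₂ := hW X Ω hle hlt z L hz hzL (fun n => (1 - σ n) / 2) hw₂ ((X : ℝ) / 2) hX2
  -- the sifted sums subtract to `∑_sifted σ`
  have hsum : ∑ n ∈ {n ∈ Icc 1 X | ∀ p ∈ Nat.primesBelow ⌈z⌉₊, n % p ∉ Ω p}, σ n =
      ∑ n ∈ {n ∈ Icc 1 X | ∀ p ∈ Nat.primesBelow ⌈z⌉₊, n % p ∉ Ω p}, (1 + σ n) / 2 -
        ∑ n ∈ {n ∈ Icc 1 X | ∀ p ∈ Nat.primesBelow ⌈z⌉₊, n % p ∉ Ω p}, (1 - σ n) / 2 := by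
    rw [← Finset.sum_sub_distrib]
    exact Finset.sum_congr rfl fun n _ => by ring
  -- the pair of remainders at `d`
  have hRd : ∀ d ∈ (primesProdBelow z).divisors.filter (fun d : ℕ => (d : ℝ) ≤ L),
      |∑ n ∈ {n ∈ Icc 1 X | ∀ q ∈ d.primeFactors, n % q ∈ Ω q}, (1 + σ n) / 2 -
          (∏ p ∈ d.primeFactors, (#(Ω p) : ℝ) / p) * ((X : ℝ) / 2)| +
        |∑ n ∈ {n ∈ Icc 1 X | ∀ q ∈ d.primeFactors, n % q ∈ Ω q}, (1 - σ n) / 2 -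
          (∏ p ∈ d.primeFactors, (#(Ω p) : ℝ) / p) * ((X : ℝ) / 2)| ≤
        (d : ℝ) + ∑ c ∈ (Finset.range d).filter (fun c : ℕ => ∀ q ∈ d.primeFactors, c % q ∈ Ω q),
          |∑ n ∈ (Finset.Icc 1 X).filter (fun n : ℕ => n % d = c), σ n| := by
    intro d hd
    have hd' := hd
    rw [Finset.mem_filter, Nat.mem_divisors] at hd'
    have hsq : Squarefree d := (squarefree_primesProdBelow z).squarefree_of_dvd hd'.1.1
    have hd0 : 0 < d := Nat.pos_of_ne_zero hsq.ne_zero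
    set Ad := {n ∈ Icc 1 X | ∀ q ∈ d.primeFactors, n % q ∈ Ω q} with hAd
    set gd := ∏ p ∈ d.primeFactors, (#(Ω p) : ℝ) / p with hgd
    have hcnt : |(#Ad : ℝ) - gd * X| ≤ d := abs_card_filter_sub_le hΩ hsq X
    have hcls := sum_filter_eq_sum_classes Ω hd0 X σ
    have e₁ : ∑ n ∈ Ad, (1 + σ n) / 2 + ∑ n ∈ Ad, (1 - σ n) / 2 = (#Ad : ℝ) := by
      rw [← Finset.sum_add_distrib, Finset.sum_congr rfl (fun n _ =>
        show (1 + σ n) / 2 + (1 - σ n) / 2 = (1 : ℝ) by ring)]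
      simp
    have e₂ : ∑ n ∈ Ad, (1 + σ n) / 2 - ∑ n ∈ Ad, (1 - σ n) / 2 = ∑ n ∈ Ad, σ n := by
      rw [← Finset.sum_sub_distrib]
      exact Finset.sum_congr rfl fun n _ => by ring
    have key := abs_add_abs_le_abs_add_add_abs_sub
      (∑ n ∈ Ad, (1 + σ n) / 2 - gd * ((X : ℝ) / 2)) (∑ n ∈ Ad, (1 - σ n) / 2 - gd * ((X : ℝ) / 2))
    have e₃ : ∑ n ∈ Ad, (1 + σ n) / 2 - gd * ((X : ℝ) / 2) +
        (∑ n ∈ Ad, (1 - σ n) / 2 - gd * ((X : ℝ) / 2)) = (#Ad : ℝ) - gd * X := by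
      rw [← e₁]; ring
    have e₄ : ∑ n ∈ Ad, (1 + σ n) / 2 - gd * ((X : ℝ) / 2) -
        (∑ n ∈ Ad, (1 - σ n) / 2 - gd * ((X : ℝ) / 2)) = ∑ n ∈ Ad, σ n := by
      rw [← e₂]; ring
    rw [e₃, e₄] at key
    refine key.trans (add_le_add hcnt ?_)
    rw [hcls]
    exact Finset.abs_sum_le_sum_abs _ _
  -- `∑_{d ∣ P(z), d ≤ L} d ≤ L²`
  have hL0 : 0 ≤ L := by linarith
  have hL2 : ∑ d ∈ (primesProdBelow z).divisors.filter (fun d : ℕ => (d : ℝ) ≤ L), (d : ℝ) ≤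
      L ^ 2 := by
    have h1 : ∀ d ∈ (primesProdBelow z).divisors.filter (fun d : ℕ => (d : ℝ) ≤ L),
        (d : ℝ) ≤ L := fun d hd => (Finset.mem_filter.mp hd).2
    have h2 : (#((primesProdBelow z).divisors.filter (fun d : ℕ => (d : ℝ) ≤ L)) : ℝ) ≤ L := by
      have hsub : (primesProdBelow z).divisors.filter (fun d : ℕ => (d : ℝ) ≤ L) ⊆
          Icc 1 ⌊L⌋₊ := by
        intro d hd
        rw [Finset.mem_filter, Nat.mem_divisors] at hd
        rw [Finset.mem_Icc]
        exact ⟨Nat.pos_of_dvd_of_pos hd.1.1 (Nat.pos_of_ne_zero hd.1.2), Nat.le_floor hd.2⟩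
      calc (#((primesProdBelow z).divisors.filter (fun d : ℕ => (d : ℝ) ≤ L)) : ℝ)
          ≤ #(Icc 1 ⌊L⌋₊) := by exact_mod_cast Finset.card_le_card hsub
        _ = ((⌊L⌋₊ : ℕ) : ℝ) := by rw [Nat.card_Icc, Nat.add_sub_cancel]
        _ ≤ L := Nat.floor_le hL0
    calc ∑ d ∈ (primesProdBelow z).divisors.filter (fun d : ℕ => (d : ℝ) ≤ L), (d : ℝ)
        ≤ #((primesProdBelow z).divisors.filter (fun d : ℕ => (d : ℝ) ≤ L)) • L :=
          Finset.sum_le_card_nsmul _ _ _ h1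
      _ = (#((primesProdBelow z).divisors.filter (fun d : ℕ => (d : ℝ) ≤ L)) : ℝ) * L := by
          rw [nsmul_eq_mul]
      _ ≤ L * L := mul_le_mul_of_nonneg_right h2 hL0
      _ = L ^ 2 := (sq L).symm
  -- conclusion
  rw [hsum]
  refine (abs_sub_le_of_two_sided h₁ h₂ hRd hL2).trans_eq ?_
  ring

end IntervalClassSieve

end Literature.NumberTheory.Sieve
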